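import Mathlib
import Summits.QuantumAdvantage.QuantumAdvantage.Theorems.MobiusLadderDigitPolyUniformityLAREvalMemLowDeg
import Summits.QuantumAdvantage.QuantumAdvantage.Theorems.MobiusLadderDigitPolyUniformityLARCorrCubeOfRange
import Literature.NumberTheory.LFunctions.MoebiusWalshCircuitsACdProofs

/-!
# `λ` is Reed–Muller-far from every digit polynomial of degree `≤ n − 2` (unconditionally)

Stub `liouville_corr_le_of_totalDegree` (V8) of line Sketch/LAR of crux stmt-QuantumAdvantage-1392
(`DigitPolyUniformity`, route `MobiusLadder`): for EVERY `P ∈ 𝔽₂[x_0, …, x_{n−1}]` of total degree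
`≤ d`, `d + 1 ≤ n`, `Σ_{N < 2ⁿ} λ(N) (−1)^{[P(bits N) = 1]} ≤ 2ⁿ − 2^{n−1−d}`, i.e. `[P = 1]`
disagrees with `[λ = −1]` on at least `2^{n−2−d}` points of `[0, 2ⁿ)`; in particular no polynomial
of degree `≤ n − 2` computes `[λ = −1]` on `[0, 2ⁿ)`. The bound is exponentially weak in `d`; it is
what multiplicativity at the prime `2` alone gives (the calibration point of the line: the `AC⁰[⊕]`
rung needs an error independent of `d`).

## Proof

Write `n = m + 1`, `p(b) = P(b)` for `b ∈ {0,1}^{m+1}` (a function in Smolensky's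
`lowDeg 𝔽₂ (m+1) d`, `stub_eval_mem_lowDeg`) and `t(N) = λ(N)(−1)^{[p(bits N) = 1]}`.

* **Reed–Muller minimum distance** (`DegreeDistance.rm_distance`, any field `F`; MacWilliams–Sloane
  1977, Ch. 13 Thm. 3 for `𝔽₂`): a non-zero `f ∈ lowDeg F m d` is non-zero on at least `2^{m−d}`
  points of `{0,1}^m`. Induction on `m`, splitting a pivot variable `x_i ← c` (`Fin.insertNth`): on
  a monomial, `x_S(insertNth i c x) = [i ∈ S → c] · x_{S'}(x)` with `|S'| ≤ |S|`, and
  `|S'| ≤ |S| − 1` if `i ∈ S` (`mono_insertNth`), so both restrictions have degree `≤ d` and their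
  difference `≤ d − 1`; the non-zero count splits over the two (`card_filter_ne_zero_eq_add`).
* **The doubling defect** `x ↦ 1 − (p(x, 0) − p(0, x))` on `{0,1}^m` has degree `≤ d` and value `1`
  at `x = 0`, so (over `𝔽₂`) `p(x,0) = p(0,x)` on `≥ 2^{m−d}` points
  (`le_card_filter_snoc_eq_cons`). For `M = val x < 2^m` the digits of `M` in `m + 1` bits are
  `(x, 0)`, those of `2M` are `(0, x)`, and `λ(2M) = −λ(M)` (the tree's
  `Green2012.liouville_two_mul`), so `t(M) + t(2M) = 0` there and `≤ 2` elsewhere: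
  `Σ_{M < 2^m} (t(M) + t(2M)) ≤ 2·2^m − 2·2^{m−d}` (`sum_pair_le`).
* **Two decompositions of `S = Σ_{N<2^{m+1}} t(N)`** (`t ≤ 1` pointwise): by halves,
  `S ≤ Σ_{M<2^m} t(M) + 2^m`; by the even numbers `2M`, `M < 2^m`, and the rest,
  `S ≤ Σ_{M<2^m} t(2M) + 2^m`. Adding, `2S ≤ 4·2^m − 2·2^{m−d}`.
-/

namespace Summit.QuantumAdvantage.DigitPolyUniformity.SketchLAR

open Finset
open Literature.Computability.MetaComplexity (boolFunEquivFin)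
open Literature.Computability.MetaComplexity.Smolensky (CubeFn mono lowDeg mono_mem_lowDeg)
open Literature.NumberTheory.LFunctions.Green2012 (liouville_two_mul)

namespace DegreeDistance

section Field

variable {F : Type*} [Field F]

/-- **A monomial under the substitution `x_i ← c`.** For `S ⊆ {0, …, m}`, a pivot `i` and a bit `c`,
`x_S(insertNth i c x) = [i ∈ S → c = 1] · x_{S'}(x)` where `S' = {j : succAbove i j ∈ S}` are the
remaining variables of `S`, re-indexed. [folklore] -/
theorem mono_insertNth {m : ℕ} (S : Finset (Fin (m + 1))) (i : Fin (m + 1)) (c : Bool)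
    (x : Fin m → Bool) :
    mono F S (Fin.insertNth i c x : Fin (m + 1) → Bool) =
      (if i ∈ S then (if c then (1 : F) else 0) else 1) *
        mono F (univ.filter fun j : Fin m => i.succAbove j ∈ S) x := by
  simp only [Literature.Computability.MetaComplexity.Smolensky.mono]
  rw [← Fintype.prod_extend_by_one S, Fin.prod_univ_succAbove _ i, Finset.prod_filter]
  simp only [Fin.insertNth_apply_same, Fin.insertNth_apply_succAbove]

/-- The re-indexed remaining variables `S' = {j : succAbove i j ∈ S}` are at most `|S|` many
(`succAbove i` is injective). [folklore] -/
theorem card_filter_succAbove_le {m : ℕ} (S : Finset (Fin (m + 1))) (i : Fin (m + 1)) :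
    (univ.filter fun j : Fin m => i.succAbove j ∈ S).card ≤ S.card :=
  Finset.card_le_card_of_injOn i.succAbove (fun _ hj => (Finset.mem_filter.1 hj).2)
    Fin.succAbove_right_injective.injOn

/-- If the pivot `i` lies in `S`, the remaining variables are at most `|S| − 1` many (they map
injectively into `S ∖ {i}`). [folklore] -/
theorem card_filter_succAbove_le_pred {m : ℕ} {S : Finset (Fin (m + 1))} {i : Fin (m + 1)}
    (hi : i ∈ S) : (univ.filter fun j : Fin m => i.succAbove j ∈ S).card ≤ S.card - 1 := by
  rw [← Finset.card_erase_of_mem hi]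
  exact Finset.card_le_card_of_injOn i.succAbove
    (fun j hj => Finset.mem_erase.2 ⟨Fin.succAbove_ne i j, (Finset.mem_filter.1 hj).2⟩)
    Fin.succAbove_right_injective.injOn

/-- A linear map sending every monomial `x_S`, `|S| ≤ d`, into a submodule `N` maps all of
`lowDeg F k d = span {x_S : |S| ≤ d}` into `N`. [folklore] -/
theorem map_lowDeg_le {k m d : ℕ} {N : Submodule F (CubeFn F m)} (L : CubeFn F k →ₗ[F] CubeFn F m)
    (hL : ∀ S : Finset (Fin k), S.card ≤ d → L (mono F S) ∈ N) {f : CubeFn F k}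
    (hf : f ∈ lowDeg F k d) : L f ∈ N := by
  rw [Literature.Computability.MetaComplexity.Smolensky.lowDeg_eq_span] at hf
  have h : Submodule.span F (Set.range fun S : {S : Finset (Fin k) // S.card ≤ d} => mono F S.1) ≤
      N.comap L := by
    rw [Submodule.span_le]
    rintro _ ⟨⟨S, hS⟩, rfl⟩
    exact hL S hS
  exact h hf

/-- The substitution `x_i ← c` as a linear map, on a monomial:
`x_S ∘ insertNth i c = [i ∈ S → c = 1] • x_{S'}`. [folklore] -/
theorem funLeft_insertNth_mono {m : ℕ} (S : Finset (Fin (m + 1))) (i : Fin (m + 1)) (c : Bool) :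
    LinearMap.funLeft F F (Fin.insertNth (α := fun _ => Bool) i c) (mono F S) =
      (if i ∈ S then (if c then (1 : F) else 0) else 1) •
        mono F (univ.filter fun j : Fin m => i.succAbove j ∈ S) := by
  funext x
  rw [LinearMap.funLeft_apply, Pi.smul_apply, smul_eq_mul]
  exact mono_insertNth S i c x

/-- **Substituting a constant for one variable does not raise the degree**:
`f ∈ lowDeg F (m+1) d ⇒ f ∘ insertNth i c ∈ lowDeg F m d`. [folklore] -/
theorem comp_insertNth_mem_lowDeg {m d : ℕ} {f : CubeFn F (m + 1)} (hf : f ∈ lowDeg F (m + 1) d)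
    (i : Fin (m + 1)) (c : Bool) :
    f ∘ (Fin.insertNth (α := fun _ => Bool) i c) ∈ lowDeg F m d := by
  have hL : ∀ S : Finset (Fin (m + 1)), S.card ≤ d →
      LinearMap.funLeft F F (Fin.insertNth (α := fun _ => Bool) i c) (mono F S) ∈
        lowDeg F m d := fun S hS => by
    rw [funLeft_insertNth_mono]
    exact Submodule.smul_mem _ _ (mono_mem_lowDeg ((card_filter_succAbove_le S i).trans hS))
  exact map_lowDeg_le _ hL hf

/-- **The two substitutions `x_i ← 1`, `x_i ← 0` differ by a function of degree `≤ d − 1`**: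
on a monomial the difference is `x_{S'}` if `i ∈ S` (`|S'| ≤ |S| − 1`) and `0` otherwise.
[folklore] -/
theorem sub_comp_insertNth_mem_lowDeg {m d : ℕ} {f : CubeFn F (m + 1)}
    (hf : f ∈ lowDeg F (m + 1) d) (i : Fin (m + 1)) :
    f ∘ (Fin.insertNth (α := fun _ => Bool) i true) -
        f ∘ (Fin.insertNth (α := fun _ => Bool) i false) ∈ lowDeg F m (d - 1) := by
  have hL : ∀ S : Finset (Fin (m + 1)), S.card ≤ d →
      (LinearMap.funLeft F F (Fin.insertNth (α := fun _ => Bool) i true) -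
          LinearMap.funLeft F F (Fin.insertNth (α := fun _ => Bool) i false))
        (mono F S) ∈ lowDeg F m (d - 1) := fun S hS => by
    rw [LinearMap.sub_apply, funLeft_insertNth_mono, funLeft_insertNth_mono, ← sub_smul]
    by_cases hi : i ∈ S
    · rw [if_pos hi, if_pos hi, if_pos rfl, if_neg Bool.false_ne_true, sub_zero, one_smul]
      exact mono_mem_lowDeg ((card_filter_succAbove_le_pred hi).trans (Nat.sub_le_sub_right hS 1))
    · rw [if_neg hi, if_neg hi, sub_self, zero_smul]
      exact Submodule.zero_mem _
  have key := map_lowDeg_le _ hL hf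
  rwa [LinearMap.sub_apply] at key

/-- **Degree `0` means constant**: `f ∈ lowDeg F k 0 ⇒ f ≡ a` for some `a ∈ F`. [folklore] -/
theorem exists_const_of_mem_lowDeg_zero {k : ℕ} {f : CubeFn F k} (hf : f ∈ lowDeg F k 0) :
    ∃ a : F, f = fun _ => a := by
  rw [Literature.Computability.MetaComplexity.Smolensky.lowDeg_eq_span] at hf
  induction hf using Submodule.span_induction with
  | mem x hx =>
    obtain ⟨⟨S, hS⟩, rfl⟩ := hx
    obtain rfl : S = ∅ := Finset.card_eq_zero.1 (Nat.le_zero.1 hS)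
    exact ⟨1, funext fun b => by simp⟩
  | zero => exact ⟨0, rfl⟩
  | add x y _ _ hx hy =>
    obtain ⟨a, rfl⟩ := hx
    obtain ⟨b, rfl⟩ := hy
    exact ⟨a + b, rfl⟩
  | smul c x _ hx =>
    obtain ⟨a, rfl⟩ := hx
    exact ⟨c • a, rfl⟩

variable [DecidableEq F]

/-- **The non-zero count splits over a pivot variable**:
`#{x : f x ≠ 0} = #{x' : f(insertNth i 1 x') ≠ 0} + #{x' : f(insertNth i 0 x') ≠ 0}`. [folklore] -/
theorem card_filter_ne_zero_eq_add {m : ℕ} (f : CubeFn F (m + 1)) (i : Fin (m + 1)) :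
    (univ.filter fun x : Fin (m + 1) → Bool => f x ≠ 0).card =
      (univ.filter fun x : Fin m → Bool =>
          (f ∘ (Fin.insertNth (α := fun _ => Bool) i true)) x ≠ 0).card +
        (univ.filter fun x : Fin m → Bool =>
          (f ∘ (Fin.insertNth (α := fun _ => Bool) i false)) x ≠ 0).card := by
  simp only [Finset.card_filter, Function.comp_apply]
  rw [← (Fin.insertNthEquiv (fun _ => Bool) i).sum_comp, Fintype.sum_prod_type, Fintype.sum_bool]
  rfl

/-- A non-zero function on the cube is non-zero somewhere: `1 ≤ #{x : f x ≠ 0}`. [folklore] -/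
theorem one_le_card_filter_ne_zero {k : ℕ} {f : CubeFn F k} (hf : f ≠ 0) :
    1 ≤ (univ.filter fun x : Fin k → Bool => f x ≠ 0).card := by
  obtain ⟨x, hx⟩ := Function.ne_iff.1 hf
  exact Finset.one_le_card.2 ⟨x, Finset.mem_filter.2 ⟨Finset.mem_univ _, hx⟩⟩

/-- **Reed–Muller minimum distance on the cube (any field).** A non-zero function of degree `≤ d`
on `{0,1}^m` — an element of Smolensky's `lowDeg F m d`, the span of the multilinear monomials
`x_S`, `|S| ≤ d` — is non-zero on at least `2^{m−d}` points. (Over `𝔽₂` this is the minimum distance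
`2^{m−d}` of the Reed–Muller code `RM(d, m)`, MacWilliams–Sloane 1977, Ch. 13 Thm. 3; the induction
on `m` splitting one variable works over every field.) [folklore] -/
theorem rm_distance {m : ℕ} : ∀ {d : ℕ} {f : CubeFn F m},
    f ∈ lowDeg F m d → f ≠ 0 → 2 ^ (m - d) ≤ (univ.filter fun x => f x ≠ 0).card := by
  induction m with
  | zero =>
    intro d f _ hf0
    rw [Nat.zero_sub, pow_zero]
    exact one_le_card_filter_ne_zero hf0
  | succ m ih =>
    intro d f hf hf0
    rcases Nat.eq_zero_or_pos d with rfl | hd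
    · -- degree `0`: `f` is a non-zero constant, non-zero everywhere
      obtain ⟨a, rfl⟩ := exists_const_of_mem_lowDeg_zero hf
      have ha : a ≠ 0 := fun h => hf0 (by subst h; rfl)
      rw [Finset.filter_true_of_mem fun x _ => ha, Finset.card_univ, Fintype.card_fun,
        Fintype.card_bool, Fintype.card_fin, Nat.sub_zero]
    · -- split the pivot variable `x_0`
      have h₀ := comp_insertNth_mem_lowDeg hf 0 false
      have h₁ := comp_insertNth_mem_lowDeg hf 0 true
      have hsub := sub_comp_insertNth_mem_lowDeg hf 0
      have hsplit := card_filter_ne_zero_eq_add f 0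
      have hne := one_le_card_filter_ne_zero hf0
      generalize f ∘ (Fin.insertNth (α := fun _ => Bool) 0 false) = f₀
        at h₀ hsub hsplit
      generalize f ∘ (Fin.insertNth (α := fun _ => Bool) 0 true) = f₁
        at h₁ hsub hsplit
      by_cases hz₀ : f₀ = 0
      · subst hz₀
        have hz₁ : f₁ ≠ 0 := by
          rintro rfl
          rw [hsplit] at hne
          simp at hne
        rw [sub_zero] at hsub
        calc 2 ^ (m + 1 - d) = 2 ^ (m - (d - 1)) := by congr 1; omega
          _ ≤ (univ.filter fun x : Fin m → Bool => f₁ x ≠ 0).card := ih hsub hz₁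
          _ ≤ _ := by rw [hsplit]; exact Nat.le_add_right _ _
      · by_cases hz₁ : f₁ = 0
        · subst hz₁
          rw [zero_sub] at hsub
          calc 2 ^ (m + 1 - d) = 2 ^ (m - (d - 1)) := by congr 1; omega
            _ ≤ (univ.filter fun x : Fin m → Bool => f₀ x ≠ 0).card := ih (neg_mem_iff.1 hsub) hz₀
            _ ≤ _ := by rw [hsplit]; exact Nat.le_add_left _ _
        · calc 2 ^ (m + 1 - d) ≤ 2 ^ (m - d) + 2 ^ (m - d) := by
                rw [← two_mul, ← pow_succ']
                exact Nat.pow_le_pow_right two_pos (by omega)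
            _ ≤ _ := by rw [hsplit]; exact Nat.add_le_add (ih h₁ hz₁) (ih h₀ hz₀)

end Field

/-- **The doubling defect of a low-degree function is rarely `1`.** For `p ∈ lowDeg 𝔽₂ (m+1) d`,
the points `x ∈ {0,1}^m` with `p(x, 0) = p(0, x)` (`Fin.snoc x 0`, `Fin.cons 0 x`: the digits of `M`
and of `2M` for `M = val x`) number at least `2^{m−d}`: the function `1 − (p(x,0) − p(0,x))` has
degree `≤ d` and value `1` at `x = 0`, and Reed–Muller distance applies. [folklore] -/
theorem le_card_filter_snoc_eq_cons {m d : ℕ} {p : CubeFn (ZMod 2) (m + 1)}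
    (hp : p ∈ lowDeg (ZMod 2) (m + 1) d) :
    2 ^ (m - d) ≤
      (univ.filter fun x : Fin m → Bool => p (Fin.snoc x false) = p (Fin.cons false x)).card := by
  have hA := comp_insertNth_mem_lowDeg hp (Fin.last m) false
  have hB := comp_insertNth_mem_lowDeg hp 0 false
  have h1 : (1 : CubeFn (ZMod 2) m) ∈ lowDeg (ZMod 2) m d := by
    rw [← Literature.Computability.MetaComplexity.Smolensky.mono_empty (F := ZMod 2) (n := m)]
    exact mono_mem_lowDeg (by simp)
  have hG := Submodule.sub_mem _ h1 (Submodule.sub_mem _ hA hB)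
  have hconst : ∀ i : Fin (m + 1),
      (Fin.insertNth i false (fun _ : Fin m => false) : Fin (m + 1) → Bool) = fun _ => false :=
    fun i => Fin.insertNth_eq_iff.2 ⟨rfl, rfl⟩
  have hG0 : (1 - (p ∘ (Fin.insertNth (α := fun _ => Bool) (Fin.last m) false) -
      p ∘ (Fin.insertNth (α := fun _ => Bool) 0 false)) : CubeFn (ZMod 2) m) ≠ 0 := by
    intro h
    have h0 := congr_fun h (fun _ => false)
    simp only [Pi.sub_apply, Pi.one_apply, Function.comp_apply, Pi.zero_apply, hconst, sub_self,
      sub_zero] at h0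
    exact one_ne_zero h0
  refine (rm_distance hG hG0).trans (Finset.card_le_card fun x hx => ?_)
  rw [Finset.mem_filter] at hx ⊢
  refine ⟨Finset.mem_univ _, ?_⟩
  have hx2 : 1 - (p (Fin.insertNth (Fin.last m) false x) - p (Fin.insertNth 0 false x)) ≠ 0 := hx.2
  have key : ∀ u v : ZMod 2, 1 - (u - v) ≠ 0 → u = v := by decide
  have hAB := key _ _ hx2
  simpa only [Fin.insertNth_last', Fin.insertNth_zero'] using hAB

/-- The digits of `M < 2^m` in `m + 1` bits are `(digits of M, 0)` (`Fin.snoc`). [folklore] -/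
theorem testBit_eq_snoc {m M : ℕ} (hM : M < 2 ^ m) (i : Fin (m + 1)) : Nat.testBit M i =
    (Fin.snoc (fun j : Fin m => Nat.testBit M j) false : Fin (m + 1) → Bool) i := by
  induction i using Fin.lastCases with
  | last => rw [Fin.snoc_last, Fin.val_last]; exact Nat.testBit_lt_two_pow hM
  | cast j => rw [Fin.snoc_castSucc, Fin.val_castSucc]

/-- The digits of `2M` in `m + 1` bits are `(0, digits of M)` (`Fin.cons`). [folklore] -/
theorem testBit_two_mul_eq_cons {m : ℕ} (M : ℕ) (i : Fin (m + 1)) :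
    Nat.testBit (2 * M) i =
      (Fin.cons false (fun j : Fin m => Nat.testBit M j) : Fin (m + 1) → Bool) i := by
  induction i using Fin.cases with
  | zero => simp [Nat.testBit_zero, Nat.mul_mod_right]
  | succ j => rw [Fin.cons_succ, Fin.val_succ, Nat.testBit_succ, Nat.mul_div_cancel_left M two_pos]

/-- `|λ(N)| ≤ 1`, hence `λ(N) · (±1) ≤ 1`. [folklore] -/
theorem liouville_mul_sign_le_one (N : ℕ) (q : Prop) [Decidable q] :
    ((ArithmeticFunction.liouville N : ℤ) : ℝ) * (if q then (-1 : ℝ) else 1) ≤ 1 := by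
  have h1 : |((ArithmeticFunction.liouville N : ℤ) : ℝ)| ≤ 1 := by
    rcases eq_or_ne N 0 with rfl | hN
    · simp
    · rw [ArithmeticFunction.liouville_apply hN]
      rcases neg_one_pow_eq_or ℤ (ArithmeticFunction.cardFactors N) with h | h <;> simp [h]
  have h2 : |(if q then (-1 : ℝ) else 1)| = 1 := by split_ifs <;> simp
  exact (le_abs_self _).trans (by rw [abs_mul, h2, mul_one]; exact h1)

/-- **One pair `{M, 2M}`.** For `x ∈ {0,1}^m` and `M = val x`: with
`t(N) = λ(N)(−1)^{[p(bits N)=1]}`, `t(M) + t(2M) ≤ 0` if `p(x,0) = p(0,x)` (the digits of `M`, `2M`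
are `(x,0)`, `(0,x)` and `λ(2M) = −λ(M)`), and `≤ 2` always. [folklore] -/
theorem pair_le {m : ℕ} (p : CubeFn (ZMod 2) (m + 1)) (x : Fin m → Bool) :
    ((ArithmeticFunction.liouville (boolFunEquivFin m x : ℕ) : ℤ) : ℝ) *
          (if p (fun i : Fin (m + 1) => Nat.testBit (boolFunEquivFin m x : ℕ) i) = 1
            then (-1 : ℝ) else 1) +
        ((ArithmeticFunction.liouville (2 * (boolFunEquivFin m x : ℕ)) : ℤ) : ℝ) *
          (if p (fun i : Fin (m + 1) => Nat.testBit (2 * (boolFunEquivFin m x : ℕ)) i) = 1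
            then (-1 : ℝ) else 1) ≤
      if p (Fin.snoc x false) = p (Fin.cons false x) then (0 : ℝ) else 2 := by
  set M : ℕ := (boolFunEquivFin m x : ℕ) with hM
  have hMlt : M < 2 ^ m := (boolFunEquivFin m x).isLt
  have hx : (fun j : Fin m => Nat.testBit M j) = x :=
    funext fun j => Literature.Computability.MetaComplexity.Smolensky.testBit_boolFunEquivFin x j
  have h1 : (fun i : Fin (m + 1) => Nat.testBit M i) = Fin.snoc x false := by
    funext i; rw [testBit_eq_snoc hMlt i, hx]
  have h2 : (fun i : Fin (m + 1) => Nat.testBit (2 * M) i) = Fin.cons false x := by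
    funext i; rw [testBit_two_mul_eq_cons M i, hx]
  rw [h1, h2]
  by_cases hab : p (Fin.snoc x false) = p (Fin.cons false x)
  · rw [if_pos hab, hab, liouville_two_mul, Int.cast_neg, neg_mul]
    linarith
  · rw [if_neg hab]
    linarith [liouville_mul_sign_le_one M (p (Fin.snoc x false) = 1),
      liouville_mul_sign_le_one (2 * M) (p (Fin.cons false x) = 1)]

/-- **Summing the pairs.** For `p ∈ lowDeg 𝔽₂ (m+1) d`,
`Σ_{x ∈ {0,1}^m} (t(val x) + t(2 val x)) ≤ 2·2^m − 2·2^{m−d}`: the pairs with `p(x,0) = p(0,x)`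
contribute `≤ 0` and there are at least `2^{m−d}` of them (`le_card_filter_snoc_eq_cons`), the
others contribute `≤ 2`. [folklore] -/
theorem sum_pair_le {m d : ℕ} {p : CubeFn (ZMod 2) (m + 1)} (hp : p ∈ lowDeg (ZMod 2) (m + 1) d) :
    ∑ x : Fin m → Bool,
        (((ArithmeticFunction.liouville (boolFunEquivFin m x : ℕ) : ℤ) : ℝ) *
            (if p (fun i : Fin (m + 1) => Nat.testBit (boolFunEquivFin m x : ℕ) i) = 1
              then (-1 : ℝ) else 1) +
          ((ArithmeticFunction.liouville (2 * (boolFunEquivFin m x : ℕ)) : ℤ) : ℝ) *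
            (if p (fun i : Fin (m + 1) => Nat.testBit (2 * (boolFunEquivFin m x : ℕ)) i) = 1
              then (-1 : ℝ) else 1)) ≤
      2 * (2 : ℝ) ^ m - 2 * (2 : ℝ) ^ (m - d) := by
  refine (Finset.sum_le_sum fun x _ => pair_le p x).trans ?_
  rw [Finset.sum_ite, Finset.sum_const_zero, zero_add, Finset.sum_const, nsmul_eq_mul]
  have hcard := Finset.card_filter_add_card_filter_not (s := (univ : Finset (Fin m → Bool)))
    (fun x : Fin m → Bool => p (Fin.snoc x false) = p (Fin.cons false x))
  simp only [Finset.card_univ, Fintype.card_fun, Fintype.card_bool, Fintype.card_fin] at hcard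
  have hcount := le_card_filter_snoc_eq_cons hp
  have hcardR : (((univ : Finset (Fin m → Bool)).filter
        fun x => p (Fin.snoc x false) = p (Fin.cons false x)).card : ℝ) +
      (((univ : Finset (Fin m → Bool)).filter
        fun x => ¬ p (Fin.snoc x false) = p (Fin.cons false x)).card : ℝ) = (2 : ℝ) ^ m := by
    exact_mod_cast hcard
  have hcountR : (2 : ℝ) ^ (m - d) ≤ (((univ : Finset (Fin m → Bool)).filter
      fun x => p (Fin.snoc x false) = p (Fin.cons false x)).card : ℝ) := by
    exact_mod_cast hcount
  linarith

end DegreeDistance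

/-- **Stub V8 (unconditional Reed–Muller-distance inapproximability; exact 𝔽₂-degree of `λ` is
`≥ n − 1`).** For EVERY `P ∈ 𝔽₂[x_0..x_{n−1}]` of total degree `≤ d` with `d + 1 ≤ n`:
`Σ_{N<2ⁿ} λ(N) χ_P(N) ≤ 2ⁿ − 2^{n−1−d}`, i.e. `[P = 1]` disagrees with `[λ = −1]` on at least
`2^{n−2−d}` points (so no polynomial of degree `≤ n − 2` computes `[λ = −1]` on `[0, 2ⁿ)`). Proof:
`1 − (P(x, 0) − P(0, x))` is a non-zero degree-`≤ d` function on `{0,1}^{n−1}`, so by the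
Reed–Muller minimum distance (`DegreeDistance.rm_distance`) `P(bits M) = P(bits 2M)` for
`≥ 2^{n−1−d}` values `M < 2^{n−1}`; there `λ(2M) = −λ(M)` cancels the terms at `M` and `2M`, and the
two decompositions of the sum (by halves; by even numbers and the rest) give
`2 Σ ≤ 4·2^{n−1} − 2·2^{n−1−d}`. [folklore] -/
theorem liouville_corr_le_of_totalDegree {n d : ℕ} (hd : d + 1 ≤ n) (P : MvPolynomial (Fin n) (ZMod 2))
    (hP : P.totalDegree ≤ d) :
    ∑ N ∈ Finset.range (2 ^ n), ((ArithmeticFunction.liouville N : ℤ) : ℝ) *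
        (if MvPolynomial.eval (fun i : Fin n => if Nat.testBit N i then (1 : ZMod 2) else 0) P = 1
          then (-1 : ℝ) else 1) ≤ (2 : ℝ) ^ n - (2 : ℝ) ^ (n - 1 - d) := by
  obtain ⟨m, rfl⟩ : ∃ m, n = m + 1 := ⟨n - 1, by omega⟩
  set t : ℕ → ℝ := fun N => ((ArithmeticFunction.liouville N : ℤ) : ℝ) *
      (if MvPolynomial.eval (fun i : Fin (m + 1) => if Nat.testBit N i then (1 : ZMod 2) else 0) P
          = 1 then (-1 : ℝ) else 1) with ht
  have ht1 : ∀ N, t N ≤ 1 := fun N => DegreeDistance.liouville_mul_sign_le_one N _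
  have hp : (fun b : Fin (m + 1) → Bool =>
      MvPolynomial.eval (fun i => if b i then (1 : ZMod 2) else 0) P) ∈ lowDeg (ZMod 2) (m + 1) d :=
    stub_eval_mem_lowDeg P hP
  have hpair : ∑ M ∈ range (2 ^ m), (t M + t (2 * M)) ≤ 2 * (2 : ℝ) ^ m - 2 * 2 ^ (m - d) := by
    rw [CorrCubeOfRange.sum_range_eq_sum_cube (fun M => t M + t (2 * M))]
    exact DegreeDistance.sum_pair_le hp
  rw [Finset.sum_add_distrib] at hpair
  -- decomposition by halves
  have ha : ∑ N ∈ range (2 ^ (m + 1)), t N ≤ ∑ M ∈ range (2 ^ m), t M + (2 : ℝ) ^ m := by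
    rw [pow_succ, mul_two, Finset.sum_range_add]
    have h1 : ∑ M ∈ range (2 ^ m), t (2 ^ m + M) ≤ (2 : ℝ) ^ m := by
      refine (Finset.sum_le_sum fun N _ => ht1 _).trans ?_
      rw [Finset.sum_const, Finset.card_range, nsmul_eq_mul, mul_one]
      simp
    linarith
  -- decomposition by the even numbers `2M`, `M < 2^m`, and the rest
  have hb : ∑ N ∈ range (2 ^ (m + 1)), t N ≤ ∑ M ∈ range (2 ^ m), t (2 * M) + (2 : ℝ) ^ m := by
    have hinj : Set.InjOn (fun M : ℕ => 2 * M) ↑(range (2 ^ m)) := fun a _ b _ hab =>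
      Nat.eq_of_mul_eq_mul_left two_pos hab
    have hsub : (range (2 ^ m)).image (fun M : ℕ => 2 * M) ⊆ range (2 ^ (m + 1)) := by
      intro N hN
      rw [Finset.mem_image] at hN
      obtain ⟨M, hM, rfl⟩ := hN
      rw [Finset.mem_range] at hM ⊢; rw [pow_succ]; omega
    have h1 : ∑ N ∈ range (2 ^ (m + 1)) \ (range (2 ^ m)).image (fun M : ℕ => 2 * M), t N ≤
        (2 : ℝ) ^ m := by
      refine (Finset.sum_le_sum fun N _ => ht1 N).trans ?_
      rw [Finset.sum_const, nsmul_eq_mul, mul_one, Finset.card_sdiff_of_subset hsub,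
        Finset.card_image_of_injOn hinj, Finset.card_range, Finset.card_range]
      have h2 : 2 ^ (m + 1) - 2 ^ m = 2 ^ m := by rw [pow_succ]; omega
      rw [h2]
      simp
    rw [← Finset.sum_sdiff hsub, Finset.sum_image hinj]
    linarith
  -- combine: `2 Σ ≤ 4·2^m − 2·2^{m−d}`
  have hmd : m + 1 - 1 - d = m - d := by omega
  rw [hmd, pow_succ (2 : ℝ) m]
  linarith
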